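import Literature.NumberTheory.Rogawski1990.RankOneKappaVertexCoverWild      -- ★ p844030 (this seat): brings ★ p844018∕p843891∕p843858, `isCompact_isOpen_conjGlInt_subgroupOf_unitary`, `cmLocalIntegralLevel` API
import HarnessLib

/-!
# The stabiliser of the root vertex under `ρ_w` is an open compact subgroup of `U(Φ₂)(L⁺_v)` — both dyadic types (road W′ = «R1LL-WILD», socket (B6-K), RULING A-47)

Topic `NumberTheory/Rogawski1990`; namespace `Literature.NumberTheory.Rogawski1990`.  THEOREMS ONLY (no definition, no instance, no notation, no named fact, no `sorry`).
Cell `pub/hodgecm-mathlib`, crux H413 = `stmt-HodgeConjecture-24833`, line «N6nsGerm», road W′ (architect A-p16 (g28) RULING A-47; HEAD F0P3a-p03 (g13) contract v3 binders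
`(K x₀ hx₀ hK hKo hKc)` lines 60–63; seat F0P3a-p04 (g14)).  HONEST LABEL: HC_CM is proved only modulo the printed citations until rung 0 closes; nothing printed is asserted here.

`exists_rootStabilizer_rhoVertexActPlace`: at a RAMIFIED non-split place `w ∣ v`, for the anti-fixed `α` of EITHER type (`|α|_w = 1` or `exp(−1)`, ★ p843768) and the root
`x₀ = latt 1` of the tree of `SL₂(L⁺_v)`, there is a subgroup `K ≤ U(Φ₂)(L⁺_v)` with `g ∈ K ↔ ρ_w(e₂ g) · x₀ = x₀` and `K × U(Φ₁)(L⁺_v)` OPEN and COMPACT in `H_v`.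
`√u`-type: `K = U(Φ₂)(𝒪_v)` (★ `forall_coe_mem_glInt_iff_rhoVertexActPlace_root_eq`, ★ `isCompact_isOpen_cmLocalIntegralLevel`).  `√π`-type: `x₀ = ρ_w(y) · v₁` for some `y`
(one vertex orbit, ★ `exists_rhoVertexActPlace_eq'`) and `Stab(v₁) = U_w ∩ D_η GL₂(𝒪_w) D_η⁻¹` (★ `forall_coe_mem_map_conj_glDiagonal_iff_rhoVertexActPlace_next_eq`), so
`K = e₂⁻¹(y · (U_w ∩ D_η GL₂(𝒪_w) D_η⁻¹) · y⁻¹)` — compact open as a conjugate of ★ `isCompact_isOpen_conjGlInt_subgroupOf_unitary`.  `U(Φ₁)(L⁺_v)` is compact (★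
`compactSpace_cmDatum_local_one_of_smul_eq`). [cite: Tits1979, §2.7, §3.2, §3.9] [cite: Serre1980Trees, Ch. II §1.3] [cite: PlatonovRapinchuk1994, §5.1]

## References
* [Tits1979] J. Tits, *Reductive groups over local fields*, PSPM 33.1 (1979), §2.7, §3.2, §3.9.
* [Serre1980Trees] J.-P. Serre, *Trees* (1980), Ch. II §1.3.
* [PlatonovRapinchuk1994] V. Platonov, A. Rapinchuk, *Algebraic Groups and Number Theory* (1994), §5.1.
-/

set_option autoImplicit false

noncomputable section

open scoped WithZero ValuativeRel Matrix MatrixGroups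
open Matrix WithZero ValuativeRel NumberField IsDedekindDomain Topology

namespace Literature.NumberTheory.Rogawski1990

open Literature.NumberTheory.Automorphic Literature.NumberTheory.Automorphic.UnitaryGroup Literature.NumberTheory.Automorphic.HermitianLatticeTree
  Literature.NumberTheory.GaloisRepresentations

variable (L : Type) [Field L] [NumberField L] [IsCMField L] (v : HeightOneSpectrum (𝓞 ↥(maximalRealSubfield L)))
  (w : PlacesOver L v) (hw : IsCMField.complexConj L • w.1 = w.1)

-- `L_w`-sized statement: elaboration budget only (no search)
set_option maxHeartbeats 800000 in
/-- **(B6-K) THE ROOT STABILISER UNDER `ρ_w` IS AN OPEN COMPACT SUBGROUP, BOTH DYADIC TYPES** (see the module docstring). [cite: Tits1979, §2.7, §3.2, §3.9]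
[cite: Serre1980Trees, Ch. II §1.3] [cite: PlatonovRapinchuk1994, §5.1] -/
theorem exists_rootStabilizer_rhoVertexActPlace (he : v.asIdeal.ramificationIdx' w.1.asIdeal ≠ 1)
    {α : w.1.adicCompletion L} (hα : galAdicCompletionMap (L := L) (IsCMField.complexConj L) hw α = -α) (hα0 : α ≠ 0)
    (hvα : Valued.v α = 1 ∨ Valued.v α = WithZero.exp (-1 : ℤ))
    {ϖF : v.adicCompletion ↥(maximalRealSubfield L)} (hϖF : Valued.v ϖF = WithZero.exp (-1 : ℤ))
    (E₂ : (cmDatum L 2 (Matrix.of fun i j : Fin 2 => if i.val + j.val + 1 = 2 then (1 : L) else 0)).Local v ≃ₜ* ↥(unitaryGroupOfForm (galAdicCompletionMap (L := L) (IsCMField.complexConj L) hw) (placeForm (Matrix.of fun i j : Fin 2 => if i.val + j.val + 1 = 2 then (1 : L) else 0) w.1)))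
    (hE₂ : ∀ g, ((E₂ g : ↥(unitaryGroupOfForm (galAdicCompletionMap (L := L) (IsCMField.complexConj L) hw) (placeForm (Matrix.of fun i j : Fin 2 => if i.val + j.val + 1 = 2 then (1 : L) else 0) w.1))) : GL (Fin 2) (w.1.adicCompletion L)) = ((localNonsplitEquiv (IsCMField.complexConj L) (Matrix.of fun i j : Fin 2 => if i.val + j.val + 1 = 2 then (1 : L) else 0) (IsCMField.complexConj_ne_one L) w hw g : ↥(unitaryGroupOfForm (galAdicCompletionMap (L := L) (IsCMField.complexConj L) hw) (placeForm (Matrix.of fun i j : Fin 2 => if i.val + j.val + 1 = 2 then (1 : L) else 0) w.1))) : GL (Fin 2) (w.1.adicCompletion L)))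
    (x₀ : {M : Submodule 𝒪[v.adicCompletion ↥(maximalRealSubfield L)] (Fin 2 → v.adicCompletion ↥(maximalRealSubfield L)) // IsSpecialLattice (RingHom.id _) ϖF !![(0 : v.adicCompletion ↥(maximalRealSubfield L)), 1; -1, 0] M})
    (hx₀ : x₀.1 = latt (1 : Matrix (Fin 2) (Fin 2) (v.adicCompletion ↥(maximalRealSubfield L)))) :
    ∃ K : Subgroup ((cmDatum L 2 (Matrix.of fun i j : Fin 2 => if i.val + j.val + 1 = 2 then (1 : L) else 0)).Local v),
      (∀ g, g ∈ K ↔ rhoVertexActPlace L v w hw hα hα0 hϖF (E₂ g) x₀ = x₀) ∧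
      IsOpen ((((K.prod (⊤ : Subgroup ((cmDatum L 1 (Matrix.of fun i j : Fin 1 => if i.val + j.val + 1 = 1 then (1 : L) else 0)).Local v))) : Subgroup ((cmDatum L 2 (Matrix.of fun i j : Fin 2 => if i.val + j.val + 1 = 2 then (1 : L) else 0)).Local v × (cmDatum L 1 (Matrix.of fun i j : Fin 1 => if i.val + j.val + 1 = 1 then (1 : L) else 0)).Local v))) : Set ((cmDatum L 2 (Matrix.of fun i j : Fin 2 => if i.val + j.val + 1 = 2 then (1 : L) else 0)).Local v × (cmDatum L 1 (Matrix.of fun i j : Fin 1 => if i.val + j.val + 1 = 1 then (1 : L) else 0)).Local v)) ∧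
      IsCompact ((((K.prod (⊤ : Subgroup ((cmDatum L 1 (Matrix.of fun i j : Fin 1 => if i.val + j.val + 1 = 1 then (1 : L) else 0)).Local v))) : Subgroup ((cmDatum L 2 (Matrix.of fun i j : Fin 2 => if i.val + j.val + 1 = 2 then (1 : L) else 0)).Local v × (cmDatum L 1 (Matrix.of fun i j : Fin 1 => if i.val + j.val + 1 = 1 then (1 : L) else 0)).Local v))) : Set ((cmDatum L 2 (Matrix.of fun i j : Fin 2 => if i.val + j.val + 1 = 2 then (1 : L) else 0)).Local v × (cmDatum L 1 (Matrix.of fun i j : Fin 1 => if i.val + j.val + 1 = 1 then (1 : L) else 0)).Local v)) := by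
  haveI : IsDiscreteValuationRing 𝒪[v.adicCompletion ↥(maximalRealSubfield L)] := isDiscreteValuationRing_integer_of_compatible hϖF
  haveI hc1 : CompactSpace ((cmDatum L 1 (Matrix.of fun i j : Fin 1 => if i.val + j.val + 1 = 1 then (1 : L) else 0)).Local v) :=
    compactSpace_cmDatum_local_one_of_smul_eq L (Matrix.of fun i j : Fin 1 => if i.val + j.val + 1 = 1 then (1 : L) else 0) w hw (isUnit_placeForm_antidiagOne (E := L) 1 w.1)
  -- `prod ⊤` bookkeeping: it suffices to produce `K` open and compact in `U(Φ₂)(L⁺_v)`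
  have hprod : ∀ K : Subgroup ((cmDatum L 2 (Matrix.of fun i j : Fin 2 => if i.val + j.val + 1 = 2 then (1 : L) else 0)).Local v),
      IsOpen ((K : Set ((cmDatum L 2 (Matrix.of fun i j : Fin 2 => if i.val + j.val + 1 = 2 then (1 : L) else 0)).Local v))) → IsCompact ((K : Set ((cmDatum L 2 (Matrix.of fun i j : Fin 2 => if i.val + j.val + 1 = 2 then (1 : L) else 0)).Local v))) →
      IsOpen ((((K.prod (⊤ : Subgroup ((cmDatum L 1 (Matrix.of fun i j : Fin 1 => if i.val + j.val + 1 = 1 then (1 : L) else 0)).Local v))) : Subgroup ((cmDatum L 2 (Matrix.of fun i j : Fin 2 => if i.val + j.val + 1 = 2 then (1 : L) else 0)).Local v × (cmDatum L 1 (Matrix.of fun i j : Fin 1 => if i.val + j.val + 1 = 1 then (1 : L) else 0)).Local v))) : Set ((cmDatum L 2 (Matrix.of fun i j : Fin 2 => if i.val + j.val + 1 = 2 then (1 : L) else 0)).Local v × (cmDatum L 1 (Matrix.of fun i j : Fin 1 => if i.val + j.val + 1 = 1 then (1 : L) else 0)).Local v)) ∧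
      IsCompact ((((K.prod (⊤ : Subgroup ((cmDatum L 1 (Matrix.of fun i j : Fin 1 => if i.val + j.val + 1 = 1 then (1 : L) else 0)).Local v))) : Subgroup ((cmDatum L 2 (Matrix.of fun i j : Fin 2 => if i.val + j.val + 1 = 2 then (1 : L) else 0)).Local v × (cmDatum L 1 (Matrix.of fun i j : Fin 1 => if i.val + j.val + 1 = 1 then (1 : L) else 0)).Local v))) : Set ((cmDatum L 2 (Matrix.of fun i j : Fin 2 => if i.val + j.val + 1 = 2 then (1 : L) else 0)).Local v × (cmDatum L 1 (Matrix.of fun i j : Fin 1 => if i.val + j.val + 1 = 1 then (1 : L) else 0)).Local v)) := by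
    intro K hKo hKc
    rw [Subgroup.coe_prod, Subgroup.coe_top]
    exact ⟨hKo.prod isOpen_univ, hKc.prod isCompact_univ⟩
  rcases hvα with hvα | hvα
  · -- `√u`-type: `K = U(Φ₂)(𝒪_v)`
    refine ⟨cmLocalIntegralLevel L 2 (Matrix.of fun i j : Fin 2 => if i.val + j.val + 1 = 2 then (1 : L) else 0) v, fun g => ?_,
      hprod _ (isCompact_isOpen_cmLocalIntegralLevel L 2 (Matrix.of fun i j : Fin 2 => if i.val + j.val + 1 = 2 then (1 : L) else 0) v).2
        (isCompact_isOpen_cmLocalIntegralLevel L 2 (Matrix.of fun i j : Fin 2 => if i.val + j.val + 1 = 2 then (1 : L) else 0) v).1⟩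
    refine (mem_localIntegralLevel_iff_of_smul_eq (IsCMField.complexConj L) 2 (Matrix.of fun i j : Fin 2 => if i.val + j.val + 1 = 2 then (1 : L) else 0) (IsCMField.complexConj_ne_one L) w hw g).trans ?_
    rw [← hE₂ g]
    exact forall_coe_mem_glInt_iff_rhoVertexActPlace_root_eq L v w hw hα hα0 hϖF x₀ hx₀ hvα (E₂ g)
  · -- `√π`-type: `Stab(x₀) = y · (U_w ∩ D_η GL₂(𝒪_w) D_η⁻¹) · y⁻¹` with `ρ_w(y) v₁ = x₀`
    have h0 : ϖF ≠ 0 := (isUniformizingElement_of_v_eq hϖF).ne_zero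
    -- a uniformiser unit `η` of `L_w`
    obtain ⟨π, hπ⟩ := IsDedekindDomain.HeightOneSpectrum.valuation_exists_uniformizer L w.1
    have hηv : Valued.v (π : w.1.adicCompletion L) = WithZero.exp (-1 : ℤ) := SymplecticCartan.valued_coe_uniformizer w.1 hπ
    have hη0 : (π : w.1.adicCompletion L) ≠ 0 := fun h => by rw [h, map_zero] at hηv; exact WithZero.exp_ne_zero hηv.symm
    set η : (w.1.adicCompletion L)ˣ := Units.mk0 _ hη0 with hηdef
    have hη : Valued.v (η : w.1.adicCompletion L) = WithZero.exp (-1 : ℤ) := by rw [hηdef, Units.val_mk0]; exact hηv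
    -- the neighbour `v₁ = latt diag(1, ϖ)`
    have hv₁S : IsSpecialLattice (RingHom.id (v.adicCompletion ↥(maximalRealSubfield L))) ϖF !![(0 : v.adicCompletion ↥(maximalRealSubfield L)), 1; -1, 0]
        (latt (diagonal ![(1 : v.adicCompletion ↥(maximalRealSubfield L)), ϖF])) := by
      have h := isSpecialLattice_latt_of_valuation_det h0 (glDiagonal 2 (v.adicCompletion ↥(maximalRealSubfield L)) ![1, Units.mk0 ϖF h0]) (e := 1) (Or.inr rfl)
        (by rw [coe_glDiagonal_one_two, Units.val_mk0, det_diagonal, Fin.prod_univ_two]; simp)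
      rwa [coe_glDiagonal_one_two, Units.val_mk0] at h
    set v₁ : {M : Submodule 𝒪[v.adicCompletion ↥(maximalRealSubfield L)] (Fin 2 → v.adicCompletion ↥(maximalRealSubfield L)) //
        IsSpecialLattice (RingHom.id (v.adicCompletion ↥(maximalRealSubfield L))) ϖF !![(0 : v.adicCompletion ↥(maximalRealSubfield L)), 1; -1, 0] M} := ⟨_, hv₁S⟩ with hv₁def
    have hv₁ : v₁.1 = latt (diagonal ![(1 : v.adicCompletion ↥(maximalRealSubfield L)), ϖF]) := rfl
    -- `y` with `ρ_w(y) v₁ = x₀`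
    obtain ⟨y, hy⟩ := exists_rhoVertexActPlace_eq' L v w hw hα hα0 hϖF he v₁ x₀
    -- the level `K♯ = U_w ∩ D_η GL₂(𝒪_w) D_η⁻¹` and its conjugate by `y`
    set Ksh : Subgroup ↥(unitaryGroupOfForm (galAdicCompletionMap (L := L) (IsCMField.complexConj L) hw) (placeForm (Matrix.of fun i j : Fin 2 => if i.val + j.val + 1 = 2 then (1 : L) else 0) w.1)) :=
      (((glInt 2 (w.1.adicCompletion L)).map (MulAut.conj (glDiagonal 2 (w.1.adicCompletion L) ![1, η])).toMonoidHom).subgroupOf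
        (unitaryGroupOfForm (galAdicCompletionMap (L := L) (IsCMField.complexConj L) hw) (placeForm (Matrix.of fun i j : Fin 2 => if i.val + j.val + 1 = 2 then (1 : L) else 0) w.1))) with hKsh
    have hKsh_co := isCompact_isOpen_conjGlInt_subgroupOf_unitary L v w hw (placeForm (Matrix.of fun i j : Fin 2 => if i.val + j.val + 1 = 2 then (1 : L) else 0) w.1) (glDiagonal 2 (w.1.adicCompletion L) ![1, η])
    refine ⟨((Ksh.map (MulAut.conj y).toMonoidHom).comap E₂.toMulEquiv.toMonoidHom), fun g => ?_, ?_⟩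
    · -- membership
      rw [Subgroup.mem_comap, Subgroup.mem_map_equiv, MulAut.conj_symm_apply, hKsh, Subgroup.mem_subgroupOf, Subgroup.coe_mul, Subgroup.coe_mul, Subgroup.coe_inv]
      have hmem := forall_coe_mem_map_conj_glDiagonal_iff_rhoVertexActPlace_next_eq L v w hw hα hα0 hϖF v₁ hv₁ he hvα η hη (y⁻¹ * E₂.toMulEquiv.toMonoidHom g * y)
      rw [Subgroup.coe_mul, Subgroup.coe_mul, Subgroup.coe_inv] at hmem
      rw [hmem, rhoVertexActPlace_mul, rhoVertexActPlace_mul, hy]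
      change rhoVertexActPlace L v w hw hα hα0 hϖF y⁻¹ (rhoVertexActPlace L v w hw hα hα0 hϖF (E₂ g) x₀) = v₁ ↔ _
      constructor
      · intro h
        have h' := congrArg (rhoVertexActPlace L v w hw hα hα0 hϖF y) h
        rwa [← rhoVertexActPlace_mul, mul_inv_cancel, rhoVertexActPlace_one, hy] at h'
      · intro h
        rw [h, ← hy, ← rhoVertexActPlace_mul, inv_mul_cancel, rhoVertexActPlace_one]
    · -- open and compact: conjugate inside `U_w`, pull back along the homeomorphism `E₂`
      have himg : ((Ksh.map (MulAut.conj y).toMonoidHom : Subgroup ↥(unitaryGroupOfForm (galAdicCompletionMap (L := L) (IsCMField.complexConj L) hw) (placeForm (Matrix.of fun i j : Fin 2 => if i.val + j.val + 1 = 2 then (1 : L) else 0) w.1))) : Set ↥(unitaryGroupOfForm (galAdicCompletionMap (L := L) (IsCMField.complexConj L) hw) (placeForm (Matrix.of fun i j : Fin 2 => if i.val + j.val + 1 = 2 then (1 : L) else 0) w.1))) =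
          ((Homeomorph.mulLeft y).trans (Homeomorph.mulRight y⁻¹)) '' (Ksh : Set ↥(unitaryGroupOfForm (galAdicCompletionMap (L := L) (IsCMField.complexConj L) hw) (placeForm (Matrix.of fun i j : Fin 2 => if i.val + j.val + 1 = 2 then (1 : L) else 0) w.1))) := by
        rw [Subgroup.coe_map]; rfl
      have hco : IsCompact ((Ksh.map (MulAut.conj y).toMonoidHom : Subgroup ↥(unitaryGroupOfForm (galAdicCompletionMap (L := L) (IsCMField.complexConj L) hw) (placeForm (Matrix.of fun i j : Fin 2 => if i.val + j.val + 1 = 2 then (1 : L) else 0) w.1))) : Set ↥(unitaryGroupOfForm (galAdicCompletionMap (L := L) (IsCMField.complexConj L) hw) (placeForm (Matrix.of fun i j : Fin 2 => if i.val + j.val + 1 = 2 then (1 : L) else 0) w.1))) ∧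
          IsOpen ((Ksh.map (MulAut.conj y).toMonoidHom : Subgroup ↥(unitaryGroupOfForm (galAdicCompletionMap (L := L) (IsCMField.complexConj L) hw) (placeForm (Matrix.of fun i j : Fin 2 => if i.val + j.val + 1 = 2 then (1 : L) else 0) w.1))) : Set ↥(unitaryGroupOfForm (galAdicCompletionMap (L := L) (IsCMField.complexConj L) hw) (placeForm (Matrix.of fun i j : Fin 2 => if i.val + j.val + 1 = 2 then (1 : L) else 0) w.1))) := by
        rw [himg]
        exact ⟨hKsh_co.1.image (Homeomorph.continuous _), (Homeomorph.isOpenMap _) _ hKsh_co.2⟩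
      have hpre : (((Ksh.map (MulAut.conj y).toMonoidHom).comap E₂.toMulEquiv.toMonoidHom :
            Subgroup ((cmDatum L 2 (Matrix.of fun i j : Fin 2 => if i.val + j.val + 1 = 2 then (1 : L) else 0)).Local v)) : Set ((cmDatum L 2 (Matrix.of fun i j : Fin 2 => if i.val + j.val + 1 = 2 then (1 : L) else 0)).Local v)) =
          E₂.toHomeomorph ⁻¹' ((Ksh.map (MulAut.conj y).toMonoidHom : Subgroup ↥(unitaryGroupOfForm (galAdicCompletionMap (L := L) (IsCMField.complexConj L) hw) (placeForm (Matrix.of fun i j : Fin 2 => if i.val + j.val + 1 = 2 then (1 : L) else 0) w.1))) : Set ↥(unitaryGroupOfForm (galAdicCompletionMap (L := L) (IsCMField.complexConj L) hw) (placeForm (Matrix.of fun i j : Fin 2 => if i.val + j.val + 1 = 2 then (1 : L) else 0) w.1))) := by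
        rw [Subgroup.coe_comap]; rfl
      refine hprod _ ?_ ?_
      · rw [hpre]; exact hco.2.preimage E₂.toHomeomorph.continuous
      · rw [hpre]; exact E₂.toHomeomorph.isCompact_preimage.2 hco.1

end Literature.NumberTheory.Rogawski1990
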